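import Literature.Probability.Percolation.QuadCrossingPathCrossings
import Literature.Topology.PlaneTopology.OpenSetArcs
import HarnessLib

/-!
# Connected sets drawn on the open edges of `δℤ²` are arc-connected

Topic `Probability/Percolation`; companion to `QuadCrossingPathCrossings.lean`
(`joinedIn_inter_openEdgeUnion_of_isConnected`: a compact connected set `K` inside the drawn open
edges `openEdgeUnion δ ω` of bond percolation on `δℤ²` is path connected — Schramm–Smirnov, *On
the scaling limits of planar percolation*, Ann. Probab. 39 (2011), §1.3: "in the discrete setting
there is no difference between connected and path-connected crossings").  Here the same is
upgraded from PATHS to SIMPLE ARCS (`Literature.Topology.PlaneTopology.IsSimpleArc`, Newman's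
"simple arc": injective paths), the form needed to feed crossings of quads drawn on the lattice
into plane-topological constructions (Jordan curves through a crossing, the sub-quad thickening
lemma `Quad.exists_subquad_isCrossing_subset` of `QuadSubquadThickening.lean`):

* `exists_isSimpleArc_of_locallyStarlike` — **a preconnected set `Z ⊆ ℂ` in which every point `w`
  sees along straight segments inside `Z` all points of `Z` close to `w` is arc-connected**: the
  set of points reachable from `a` by a simple arc inside `Z` is relatively clopen (an arc to `z`
  followed by the segment `[z, w] ⊆ Z`, cut at the first point of the arc on the way back from `w`,
  is an arc to `w` — `exists_isSimpleArc_of_segment_subset`);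
* `exists_isSimpleArc_of_subset_openEdgeUnion` — **a compact connected `K ⊆ openEdgeUnion δ ω`
  (`δ > 0`) contains a simple arc between any two of its points**: `K` is locally star-like, being
  the finite union of the closed pieces `{z ∈ [δx, δy] : [δx, z] ⊆ K}` of the anchoring dichotomy
  (`segment_subset_or_segment_subset`) — near `w` only pieces through `w` are met, and two points
  of one piece see each other inside it (`segment_subset_union_of_mem_segment`: for `w, z` on a
  segment from `v`, `[w, z] ⊆ [v, w] ∪ [v, z]`).

Everything is proved; no named fact is introduced.  Mathlib has no simple arcs and no
arc-connectedness ("paths contain arcs" is absent even for the plane).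

## References

* O. Schramm, S. Smirnov, Ann. Probab. 39 (2011) 1768–1814, arXiv:1101.5820, §1.3.
  [SchrammSmirnov2011]
* M. H. A. Newman, *Elements of the topology of plane sets of points* (1939), Ch. III §1 (simple
  arcs; sums of arcs). [Newman1939]
-/

noncomputable section

open Set Metric Function Filter
open _root_.Topology
open Literature.Topology.PlaneTopology
open Literature.Probability.LatticeModels

namespace Literature.Probability.Percolation

/-! ### Sub-arcs and the extension step -/

/-- An initial sub-arc: a simple arc from `a` to `b` contains a simple arc from `a` to each of its
points `z ≠ a`. [folklore] -/
theorem _root_.Literature.Topology.PlaneTopology.IsSimpleArc.exists_subarc_left {L : Set ℂ} {a b z : ℂ} (h : IsSimpleArc L a b) (hz : z ∈ L)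
    (hza : z ≠ a) : ∃ L' ⊆ L, IsSimpleArc L' a z := by
  obtain ⟨γ, hγ, hinj, hL, h0, h1⟩ := isSimpleArc_iff_continuous.1 h
  rw [← hL] at hz
  obtain ⟨t, ht, rfl⟩ := hz
  have ht0 : 0 < t := lt_of_le_of_ne ht.1 fun h => hza (by rw [← h, h0])
  refine ⟨γ '' Icc 0 t, by rw [← hL]; exact image_mono (Icc_subset_Icc_right ht.2), ?_⟩
  have := isSimpleArc_image_Icc hγ.continuousOn hinj le_rfl ht0 ht.2
  rwa [h0] at this

/-- **Extension step.**  If `a` is joined to `z` by a simple arc `L ⊆ Z` and the segment `[z, w]`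
lies in `Z`, then `a` is joined to `w ≠ a` by a simple arc inside `Z`: follow `[w, z]` from `w` to
its first point `z'` on `L`, then the sub-arc of `L` from `z'` back to `a`. [folklore] -/
theorem exists_isSimpleArc_of_segment_subset {Z L : Set ℂ} {a z w : ℂ} (hL : IsSimpleArc L a z)
    (hLZ : L ⊆ Z) (hzw : segment ℝ z w ⊆ Z) (hwa : w ≠ a) : ∃ L' ⊆ Z, IsSimpleArc L' a w := by
  by_cases hwL : w ∈ L
  · obtain ⟨L', hL'L, hL'⟩ := hL.exists_subarc_left hwL hwa
    exact ⟨L', hL'L.trans hLZ, hL'⟩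
  · have hwz : w ≠ z := fun h => hwL (h ▸ hL.right_mem)
    have hwzZ : segment ℝ w z ⊆ Z := by rw [segment_symm]; exact hzw
    obtain ⟨M, z', hMseg, hM, hMC, -⟩ := (IsSimpleArc.segment hwz).exists_subarc_of_isClosed
      hL.isCompact.isClosed hwL hL.right_mem
    have hz'L : z' ∈ L := by
      have : z' ∈ M ∩ L := by rw [hMC]; rfl
      exact this.2
    by_cases hz'a : z' = a
    · rw [hz'a] at hM
      exact ⟨M, hMseg.trans hwzZ, hM.symm⟩
    · obtain ⟨L', hL'L, hL'⟩ := hL.exists_subarc_left hz'L hz'a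
      refine ⟨L' ∪ M, union_subset (hL'L.trans hLZ) (hMseg.trans hwzZ), hL'.union hM.symm ?_⟩
      rintro u ⟨huL', huM⟩
      have : u ∈ M ∩ L := ⟨huM, hL'L huL'⟩
      rw [hMC] at this
      exact this

/-! ### Locally star-like connected sets are arc-connected -/

/-- **A preconnected, locally star-like planar set is arc-connected.**  If `Z ⊆ ℂ` is preconnected
and every `w ∈ Z` has a radius `r > 0` such that `[w, z] ⊆ Z` for all `z ∈ Z` with
`dist z w < r`, then any two distinct points of `Z` are the end-points of a simple arc inside `Z`
(the set of points reachable from `a` by a simple arc in `Z` is relatively open and closed, by the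
extension step). [folklore] -/
theorem exists_isSimpleArc_of_locallyStarlike {Z : Set ℂ} (hZc : IsPreconnected Z)
    (hLS : ∀ w ∈ Z, ∃ r > 0, ∀ z ∈ Z, dist z w < r → segment ℝ w z ⊆ Z) {a b : ℂ} (ha : a ∈ Z)
    (hb : b ∈ Z) (hab : a ≠ b) : ∃ L ⊆ Z, IsSimpleArc L a b := by
  -- the reachable set and the extension step
  set R : Set ℂ := {w | w = a ∨ ∃ L ⊆ Z, IsSimpleArc L a w} with hR
  have hstep : ∀ z ∈ R, ∀ w, segment ℝ z w ⊆ Z → w ∈ R := by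
    intro z hz w hzw
    by_cases hwa : w = a
    · exact Or.inl hwa
    rcases hz with rfl | ⟨L, hLZ, hL⟩
    · exact Or.inr ⟨segment ℝ z w, hzw, IsSimpleArc.segment (Ne.symm hwa)⟩
    · exact Or.inr (exists_isSimpleArc_of_segment_subset hL hLZ hzw hwa)
  -- the radii, and the two open sets
  choose! r hr hrZ using hLS
  set u : Set ℂ := ⋃ z ∈ Z ∩ R, ball z (r z) with hu
  set v : Set ℂ := ⋃ w ∈ Z \ R, ball w (r w) with hv
  have huo : IsOpen u := isOpen_biUnion fun _ _ => isOpen_ball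
  have hvo : IsOpen v := isOpen_biUnion fun _ _ => isOpen_ball
  have hZu : ∀ w ∈ Z, w ∈ u → w ∈ R := fun w hw hwu => by
    obtain ⟨z, ⟨hzZ, hzR⟩, hwz⟩ := mem_iUnion₂.1 hwu
    exact hstep z hzR w (hrZ z hzZ w hw (mem_ball.1 hwz))
  have hZv : ∀ z ∈ Z, z ∈ v → z ∉ R := fun z hz hzv hzR => by
    obtain ⟨w, ⟨hwZ, hwR⟩, hzw⟩ := mem_iUnion₂.1 hzv
    have h1 : segment ℝ w z ⊆ Z := hrZ w hwZ z hz (mem_ball.1 hzw)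
    exact hwR (hstep z hzR w (by rw [segment_symm]; exact h1))
  have hcover : Z ⊆ u ∪ v := fun w hw => by
    by_cases hwR : w ∈ R
    · exact Or.inl (mem_iUnion₂.2 ⟨w, ⟨hw, hwR⟩, mem_ball_self (hr w hw)⟩)
    · exact Or.inr (mem_iUnion₂.2 ⟨w, ⟨hw, hwR⟩, mem_ball_self (hr w hw)⟩)
  have hbR : b ∈ R := by
    by_contra hbR
    obtain ⟨z, hzZ, hzu, hzv⟩ := hZc u v huo hvo hcover
      ⟨a, ha, mem_iUnion₂.2 ⟨a, ⟨ha, Or.inl rfl⟩, mem_ball_self (hr a ha)⟩⟩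
      ⟨b, hb, mem_iUnion₂.2 ⟨b, ⟨hb, hbR⟩, mem_ball_self (hr b hb)⟩⟩
    exact hZv z hzZ hzv (hZu z hzZ hzu)
  rcases hbR with h | h
  · exact absurd h.symm hab
  · exact h

/-! ### Three points on a segment -/

/-- `lineMap v (lineMap v v' s) ρ = lineMap v v' (ρ s)`. [folklore] -/
theorem lineMap_lineMap_right_zero (v v' : ℂ) (s ρ : ℝ) :
    AffineMap.lineMap v (AffineMap.lineMap v v' s) ρ = AffineMap.lineMap v v' (ρ * s) := by
  simp only [AffineMap.lineMap_apply_module', add_sub_cancel_right, smul_smul]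

/-- The initial piece `lineMap v v' ([0, s])` of a segment lies in `[v, lineMap v v' s]` (`s ≥ 0`).
[folklore] -/
theorem image_lineMap_Icc_subset_segment (v v' : ℂ) {s : ℝ} (hs : 0 ≤ s) :
    AffineMap.lineMap v v' '' Icc 0 s ⊆ segment ℝ v (AffineMap.lineMap v v' s) := by
  rintro _ ⟨ρ, hρ, rfl⟩
  rw [segment_eq_image_lineMap]
  rcases hs.eq_or_lt with h | h
  · have hρ0 : ρ = 0 := le_antisymm (h ▸ hρ.2) hρ.1
    refine ⟨0, ⟨le_rfl, zero_le_one⟩, ?_⟩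
    rw [lineMap_lineMap_right_zero, hρ0, zero_mul]
  · refine ⟨ρ / s, ⟨div_nonneg hρ.1 hs, (div_le_one h).2 hρ.2⟩, ?_⟩
    rw [lineMap_lineMap_right_zero, div_mul_cancel₀ _ h.ne']

/-- The segment between two points `lineMap v v' s`, `lineMap v v' t` of a line is the image of
the parameter interval between `s` and `t`. [folklore] -/
theorem segment_lineMap_lineMap_subset (v v' : ℂ) (s t : ℝ) :
    segment ℝ (AffineMap.lineMap v v' s) (AffineMap.lineMap v v' t) ⊆
      AffineMap.lineMap v v' '' uIcc s t := by
  rw [segment_eq_image_lineMap]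
  rintro _ ⟨ρ, hρ, rfl⟩
  refine ⟨(1 - ρ) * s + ρ * t, ?_, ?_⟩
  · rcases le_total s t with hst | hts
    · rw [uIcc_of_le hst]
      constructor <;> nlinarith [hρ.1, hρ.2]
    · rw [uIcc_of_ge hts]
      constructor <;> nlinarith [hρ.1, hρ.2]
  · simp only [AffineMap.lineMap_apply_module', Complex.real_smul]
    push_cast
    ring

/-- **Three points on a segment**: if `w`, `z` lie on the segment `[v, v']`, then
`[w, z] ⊆ [v, w] ∪ [v, z]`. [folklore] -/
theorem segment_subset_union_of_mem_segment {v v' w z : ℂ} (hw : w ∈ segment ℝ v v')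
    (hz : z ∈ segment ℝ v v') : segment ℝ w z ⊆ segment ℝ v w ∪ segment ℝ v z := by
  rw [segment_eq_image_lineMap] at hw hz
  obtain ⟨s, hs, rfl⟩ := hw
  obtain ⟨t, ht, rfl⟩ := hz
  intro u hu
  obtain ⟨ρ, hρ, rfl⟩ := segment_lineMap_lineMap_subset v v' s t hu
  rcases le_total s t with hst | hts
  · rw [uIcc_of_le hst] at hρ
    rcases le_total ρ s with h | h
    · exact Or.inl (image_lineMap_Icc_subset_segment v v' hs.1 ⟨ρ, ⟨hs.1.trans hρ.1, h⟩, rfl⟩)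
    · exact Or.inr (image_lineMap_Icc_subset_segment v v' ht.1 ⟨ρ, ⟨hs.1.trans hρ.1, hρ.2⟩, rfl⟩)
  · rw [uIcc_of_ge hts] at hρ
    rcases le_total ρ t with h | h
    · exact Or.inr (image_lineMap_Icc_subset_segment v v' ht.1 ⟨ρ, ⟨ht.1.trans hρ.1, h⟩, rfl⟩)
    · exact Or.inl (image_lineMap_Icc_subset_segment v v' hs.1 ⟨ρ, ⟨ht.1.trans hρ.1, hρ.2⟩, rfl⟩)

/-! ### Connected sets drawn on the open edges contain simple arcs -/

/-- Near a point, a finite family of closed sets shows only its members through that point.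
[folklore] -/
theorem exists_ball_forall_mem_of_finite {ι : Type*} {F : Set ι} (hF : F.Finite) {c : ι → Set ℂ}
    (hcl : ∀ i ∈ F, IsClosed (c i)) (w : ℂ) :
    ∃ r > 0, ∀ i ∈ F, (c i ∩ ball w r).Nonempty → w ∈ c i := by
  have : (⋂ i ∈ {i ∈ F | w ∉ c i}, (c i)ᶜ) ∈ 𝓝 w := by
    refine (biInter_mem (hF.subset (sep_subset _ _))).2 fun i hi => ?_
    exact (hcl i hi.1).isOpen_compl.mem_nhds hi.2
  obtain ⟨r, hr, hball⟩ := Metric.mem_nhds_iff.1 this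
  refine ⟨r, hr, fun i hi ⟨u, hui, hu⟩ => ?_⟩
  by_contra hw
  exact mem_iInter₂.1 (hball hu) i ⟨hi, hw⟩ hui

variable {δ : ℝ} {ω : BondConfig (Site 2)}

/-- **A compact connected set drawn on the open edges of `δℤ²` is arc-connected** (`δ > 0`): any
two distinct points `a`, `b` of a compact connected `K ⊆ openEdgeUnion δ ω` are the end-points of
a simple arc `L ⊆ K`.  (`K` is locally star-like — see the module docstring — and
`exists_isSimpleArc_of_locallyStarlike` applies.)
[cite: SchrammSmirnov2011, §1.3 (connected = path-connected crossings in the discrete setting)] -/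
theorem exists_isSimpleArc_of_subset_openEdgeUnion (hδ : 0 < δ) {K : Set ℂ} (hKc : IsCompact K)
    (hK : IsConnected K) (hKO : K ⊆ openEdgeUnion δ ω) {a b : ℂ} (ha : a ∈ K) (hb : b ∈ K)
    (hab : a ≠ b) : ∃ L ⊆ K, IsSimpleArc L a b := by
  refine exists_isSimpleArc_of_locallyStarlike hK.isPreconnected (fun w hw => ?_) ha hb hab
  by_cases hA : ∃ p ∈ edgePairs δ ω K, K ⊆ openSegment ℝ (meshPoint δ p.1) (meshPoint δ p.2)
  · -- `K` inside one open edge: it contains the segment between any two of its points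
    obtain ⟨p, -, hKp⟩ := hA
    exact ⟨1, one_pos, fun z hz _ => segment_subset_of_isPreconnected_subset_segment
      hK.isPreconnected (hKp.trans (openSegment_subset_segment ℝ _ _)) hw hz⟩
  push Not at hA
  -- the finitely many closed anchored pieces
  set c : Site 2 × Site 2 → Set ℂ := fun p =>
    segment ℝ (meshPoint δ p.1) (meshPoint δ p.2) ∩ {z | segment ℝ (meshPoint δ p.1) z ⊆ K} with hc
  have hfin : (edgePairs δ ω K).Finite := edgePairs_finite hKc.isBounded hδ
  have hcl : ∀ p ∈ edgePairs δ ω K, IsClosed (c p) := fun p _ =>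
    (isCompact_segment_complex _ _).isClosed.inter (isClosed_setOf_segment_subset hKc.isClosed _)
  have hcover : ∀ k ∈ K, ∃ p ∈ edgePairs δ ω K, k ∈ c p := by
    intro k hk
    obtain ⟨p, hp, hkp⟩ := exists_mem_edgePairs_of_mem hKO hk
    by_cases hka : k = meshPoint δ p.1
    · refine ⟨p, hp, hkp, ?_⟩
      show segment ℝ (meshPoint δ p.1) k ⊆ K
      rw [← hka, segment_same]; exact singleton_subset_iff.2 hk
    by_cases hkb : k = meshPoint δ p.2
    · refine ⟨p.swap, swap_mem_edgePairs hp,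
        by rw [Prod.fst_swap, Prod.snd_swap, segment_symm]; exact hkp, ?_⟩
      show segment ℝ (meshPoint δ p.swap.1) k ⊆ K
      rw [Prod.fst_swap, ← hkb, segment_same]; exact singleton_subset_iff.2 hk
    rcases segment_subset_or_segment_subset hδ hK.isPreconnected hKc.isBounded hKO hp.1 hk hkp
      hka hkb (hA p hp) with h | h
    · exact ⟨p, hp, hkp, h⟩
    · refine ⟨p.swap, swap_mem_edgePairs hp,
        by rw [Prod.fst_swap, Prod.snd_swap, segment_symm]; exact hkp, ?_⟩
      show segment ℝ (meshPoint δ p.swap.1) k ⊆ K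
      rw [Prod.fst_swap, segment_symm]; exact h
  -- near `w` only pieces through `w` are met; two points of a piece see each other inside `K`
  obtain ⟨r, hr, hrw⟩ := exists_ball_forall_mem_of_finite hfin hcl w
  refine ⟨r, hr, fun z hz hzw => ?_⟩
  obtain ⟨p, hp, hzp⟩ := hcover z hz
  have hwp : w ∈ c p := hrw p hp ⟨z, hzp, mem_ball.2 hzw⟩
  exact (segment_subset_union_of_mem_segment hwp.1 hzp.1).trans (union_subset hwp.2 hzp.2)

end Literature.Probability.Percolation
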